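import Literature.NumberTheory.LFunctions.ConreyIwaniec2002MollifierMeanSquare
import HarnessLib

/-!
# Conrey–Iwaniec (2002), §8 (8.7): Proposition 6.4 on the three windows `[T/2,T]`, `[T,2T]`, `[2T,4T]`

B. Conrey, H. Iwaniec, *Spacing of zeros of Hecke L-functions and the class number problem*,
Acta Arith. 103 (2002), §6 Proposition 6.4 (6.52) and §8 (8.7) [held text
`paper:arxiv-math_0111012`, p0016 L40–60, p0018 L150–160].

In the estimation of `A₃ = A₁₃ + A₂₃ + A₃₃` (the range `n ≫ T` of the approximate functional
equation, (8.7)) the discrete mean value of Proposition 5.4 produces the integral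
`∫_{T/2}^{3T} |Σ_n a(n)λ(n) n^{−1/2−iτ}|² dτ`, which is then bounded by Proposition 6.4 (6.52).
Since (6.52) is stated for `∫_T^{2T}`, it is applied on the three dyadic windows `[T/2,T]`,
`[T,2T]`, `[2T,4T] ⊃ [2T,3T]` — legitimately so when the SAME cut-off `a` lies in the class (6.38)
for each of the three parameters `T′ ∈ {T/2, T, 2T}` (`Y = qT′`) and `T/2 ≥ q^65`; such an `a` is
built in `ConreyIwaniec2002TailCutoff`. This file proves that bookkeeping step
(`integral_three_windows_le`): with Proposition 6.4 as the binder `h64` (BY NAME,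
`conreyIwaniec2002_proposition64`),
  `∫_{T/2}^{3T} |Σ a(n)λ(n)n^{−1/2−iτ}|² dτ ≤ (11/2)·C₆₄ · T ℒ(T) log q`,
using `ℒ(T/2) ≤ ℒ(T)`, `ℒ(2T) ≤ 2ℒ(T)` (`calL_mono`, `calL_two_mul_le`), the continuity of the
absolutely convergent series on `Re s = ½` (`continuous_LSeries_cutoff_twist`, from
`|a(n)| ≤ (Y/n)⁴`, `|λ(n)| ≤ d(n)`), and positivity. Everything PROVED; no definition.

«The programme SEARCHES and TYPES; no claim about Landau–Siegel zeros until a kernel theorem says so.»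

## References
* [ConreyIwaniec2002] B. Conrey, H. Iwaniec, Acta Arith. 103 (2002) 259–312, arXiv:math/0111012:
  Proposition 6.4 (6.52); §8 (8.7).
-/

noncomputable section

open scoped NumberField
open Complex MeasureTheory Filter Set Real

namespace Literature.NumberTheory.LFunctions

namespace ConreyIwaniec2002

open NumberField Literature.NumberTheory.LFunctions.NumberField

/-! ## §1. `ℒ(Y)` is monotone and `ℒ(2T) ≤ 2ℒ(T)` -/

/-- `ℒ(Y) ≤ ℒ(Y′)` for `0 < Y ≤ Y′`. [cite: ConreyIwaniec2002, Corollary 6.3 (6.50)] -/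
theorem calL_mono {q : ℕ} [NeZero q] (χ : DirichletCharacter ℂ q) {Y Y' : ℝ} (hY : 0 < Y)
    (hYY' : Y ≤ Y') : calL χ Y ≤ calL χ Y' := by
  unfold calL
  have h1 : 0 ≤ ‖χ.LFunction 1‖ := norm_nonneg _
  have h2 : Real.log Y ≤ Real.log Y' := Real.log_le_log hY hYY'
  gcongr

/-- `ℒ(2T) ≤ 2ℒ(T)` for `T ≥ 2` (`log 2T ≤ 2 log T`). [cite: ConreyIwaniec2002, Corollary 6.3 (6.50)] -/
theorem calL_two_mul_le {q : ℕ} [NeZero q] (χ : DirichletCharacter ℂ q) {T : ℝ} (hT : 2 ≤ T) :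
    calL χ (2 * T) ≤ 2 * calL χ T := by
  unfold calL
  have h1 : 0 ≤ ‖χ.LFunction 1‖ := norm_nonneg _
  have h3 : 0 ≤ ‖deriv χ.LFunction 1‖ := norm_nonneg _
  have hT0 : 0 < T := by linarith
  have hlog : Real.log (2 * T) ≤ 2 * Real.log T := by
    rw [Real.log_mul (by norm_num) hT0.ne']
    have : Real.log 2 ≤ Real.log T := Real.log_le_log (by norm_num) hT
    linarith
  have hlogT : 0 ≤ Real.log T := Real.log_nonneg (by linarith)
  calc ‖χ.LFunction 1‖ * (‖χ.LFunction 1‖ * Real.log (2 * T) + ‖deriv χ.LFunction 1‖)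
      ≤ ‖χ.LFunction 1‖ * (‖χ.LFunction 1‖ * (2 * Real.log T) + 2 * ‖deriv χ.LFunction 1‖) := by
        gcongr; linarith
    _ = 2 * (‖χ.LFunction 1‖ * (‖χ.LFunction 1‖ * Real.log T + ‖deriv χ.LFunction 1‖)) := by ring

/-! ## §2. The absolutely convergent series `Σ a(n)λ(n)n^{−s}` on `Re s = ½` -/

/-- A cut-off of the class (6.38) satisfies `|a(y)| ≤ (Y/y)⁴` (`y > 0`, `Y > 0`, `T ≥ 0`).
[cite: ConreyIwaniec2002, Corollary 6.2 (6.38)] -/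
theorem norm_le_of_isCutoff {a : ℝ → ℂ} {T Y : ℝ} (ha : IsCutoff a T Y) (hT : 0 ≤ T) (hY : 0 < Y)
    {y : ℝ} (hy : 0 < y) : ‖a y‖ ≤ (Y / y) ^ 4 := by
  have h := ha.2 0 (by norm_num) y hy
  simp only [pow_zero, one_mul, iteratedDeriv_zero] at h
  refine h.trans ?_
  have h1 : y / Y ≤ 1 + y / Y + T / y := by
    have : 0 ≤ T / y := div_nonneg hT hy.le
    linarith
  have h2 : 0 < y / Y := div_pos hy hY
  calc ((1 + y / Y + T / y) ^ 4)⁻¹ ≤ ((y / Y) ^ 4)⁻¹ :=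
        inv_anti₀ (pow_pos h2 4) (pow_le_pow_left₀ h2.le h1 4)
    _ = (Y / y) ^ 4 := by rw [← inv_pow, inv_div]

/-- A cut-off of the class (6.38) satisfies `|a(y)| ≤ 1` (`y > 0`, `Y > 0`, `T ≥ 0`).
[cite: ConreyIwaniec2002, Corollary 6.2 (6.38)] -/
theorem norm_le_one_of_isCutoff {a : ℝ → ℂ} {T Y : ℝ} (ha : IsCutoff a T Y) (hT : 0 ≤ T)
    (hY : 0 < Y) {y : ℝ} (hy : 0 < y) : ‖a y‖ ≤ 1 := by
  have h := ha.2 0 (by norm_num) y hy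
  simp only [pow_zero, one_mul, iteratedDeriv_zero] at h
  refine h.trans ?_
  have h1 : 1 ≤ 1 + y / Y + T / y := by
    have : 0 ≤ T / y := div_nonneg hT hy.le
    have : 0 ≤ y / Y := div_nonneg hy.le hY.le
    linarith
  exact inv_le_one_of_one_le₀ (one_le_pow₀ h1)

/-- `|λ_ψ(n)| ≤ d(n)` for a class group character of the imaginary quadratic field of discriminant
`−q`. [cite: ConreyIwaniec2002, §6 (6.42)–(6.43), §9 (9.4)] -/
theorem norm_twistCount_le_card_divisors {q : ℕ} [NeZero q] {χ : DirichletCharacter ℂ q}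
    (hprim : χ.IsPrimitive) (hquad : χ.IsQuadratic) (hodd : χ.Odd)
    (K : Type) [Field K] [NumberField K] (h2 : Module.finrank ℚ K = 2)
    (hdisc : NumberField.discr K = -(q : ℤ)) (ψ : ClassGroup (𝓞 K) →* ℂˣ) (n : ℕ) :
    ‖twistCount K (classGroupCharIdealHom ψ) n‖ ≤ n.divisors.card := by
  rcases eq_or_ne n 0 with rfl | hn
  · simp [twistCount_zero]
  · exact (norm_twistCount_le (norm_classGroupCharIdealHom_le ψ) n).trans
      (idealNormCount_le_card_divisors_of_quadratic hprim hquad hodd K h2 hdisc hn)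

/-- The terms of `Σ a(n)λ(n)n^{−s}` on `Re s = ½` are `≤ Y⁴ · d(n) n^{−9/2}` in modulus when
`|a(n)| ≤ (Y/n)⁴` and `|λ(n)| ≤ d(n)`. [cite: ConreyIwaniec2002, §8 (8.7)] -/
theorem norm_term_cutoff_twist_le {a : ℝ → ℂ} {lam : ℕ → ℂ} {Y : ℝ} (hY : 0 < Y)
    (ha : ∀ n : ℕ, 0 < n → ‖a n‖ ≤ (Y / n) ^ 4) (hlam : ∀ n : ℕ, ‖lam n‖ ≤ n.divisors.card)
    (τ : ℝ) (n : ℕ) :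
    ‖LSeries.term (fun n => a n * lam n) (1 / 2 + τ * I) n‖ ≤
      Y ^ 4 * ((n.divisors.card : ℝ) * (n : ℝ) ^ (-(9 / 2 : ℝ))) := by
  rcases eq_or_ne n 0 with rfl | hn
  · simp [LSeries.term_zero]
  have hn0 : (0 : ℝ) < n := by exact_mod_cast Nat.pos_of_ne_zero hn
  rw [LSeries.term_of_ne_zero hn, norm_div, norm_mul,
    Complex.norm_natCast_cpow_of_pos (Nat.pos_of_ne_zero hn)]
  have hre : (1 / 2 + (τ : ℂ) * I).re = 1 / 2 := by simp
  rw [hre]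
  have h1 := ha n (Nat.pos_of_ne_zero hn)
  have h2 := hlam n
  have hrpow : (Y / n) ^ 4 / (n : ℝ) ^ (1 / 2 : ℝ) = Y ^ 4 * (n : ℝ) ^ (-(9 / 2 : ℝ)) := by
    rw [div_pow, show (-(9 / 2 : ℝ)) = -(4 : ℝ) + -(1 / 2 : ℝ) by norm_num, Real.rpow_add hn0,
      Real.rpow_neg hn0.le, Real.rpow_neg hn0.le,
      show (n : ℝ) ^ (4 : ℝ) = (n : ℝ) ^ (4 : ℕ) by exact_mod_cast Real.rpow_natCast (n : ℝ) 4]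
    field_simp
  calc ‖a n‖ * ‖lam n‖ / (n : ℝ) ^ (1 / 2 : ℝ)
      ≤ (Y / n) ^ 4 * n.divisors.card / (n : ℝ) ^ (1 / 2 : ℝ) := by
        gcongr ?_ / _
        exact mul_le_mul h1 h2 (norm_nonneg _) (by positivity)
    _ = Y ^ 4 * ((n.divisors.card : ℝ) * (n : ℝ) ^ (-(9 / 2 : ℝ))) := by
        rw [mul_comm ((Y / n) ^ 4), mul_div_assoc, hrpow]; ring

/-- **Continuity of `τ ↦ Σ a(n)λ(n)n^{−1/2−iτ}`** for a bounded cut-off `|a(n)| ≤ (Y/n)⁴` and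
`|λ(n)| ≤ d(n)` (uniformly absolutely convergent: `Σ d(n)n^{−9/2} < ∞`).
[cite: ConreyIwaniec2002, §8 (8.7)] -/
theorem continuous_LSeries_cutoff_twist {a : ℝ → ℂ} {lam : ℕ → ℂ} {Y : ℝ} (hY : 0 < Y)
    (ha : ∀ n : ℕ, 0 < n → ‖a n‖ ≤ (Y / n) ^ 4) (hlam : ∀ n : ℕ, ‖lam n‖ ≤ n.divisors.card) :
    Continuous fun τ : ℝ => LSeries (fun n => a n * lam n) (1 / 2 + τ * I) := by
  have hsum : Summable fun n : ℕ => Y ^ 4 * ((n.divisors.card : ℝ) * (n : ℝ) ^ (-(9 / 2 : ℝ))) :=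
    (ZetaM4D.summable_card_divisors_mul_rpow (by norm_num)).mul_left _
  refine continuous_tsum (fun n => ?_) hsum (fun n τ => norm_term_cutoff_twist_le hY ha hlam τ n)
  rcases eq_or_ne n 0 with rfl | hn
  · simp only [LSeries.term_zero]; exact continuous_const
  have hterm : (fun τ : ℝ => LSeries.term (fun n => a n * lam n) (1 / 2 + τ * I) n) =
      fun τ : ℝ => a n * lam n * (n : ℂ) ^ (-(1 / 2 + (τ : ℂ) * I)) := by
    funext τ
    rw [LSeries.term_of_ne_zero hn, Complex.cpow_neg, div_eq_mul_inv]
  rw [hterm]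
  refine continuous_const.mul (Continuous.const_cpow (by fun_prop) (Or.inl ?_))
  exact_mod_cast hn

/-! ## §3. Proposition 6.4 on three windows -/

/-- **(6.52) on `[T/2, 3T]`** (the integral produced by Proposition 5.4 in (8.7)): if
`T ≥ 2q^65` and the cut-off `a` lies in the class (6.38) for each of `T′ = T/2, T, 2T` with
`Y = qT′`, then, with Proposition 6.4 as the binder `h64`,
`∫_{T/2}^{3T} |Σ_n a(n)λ(n)n^{−1/2−iτ}|² dτ ≤ (11/2)·C₆₄·T ℒ(T) log q`.
[cite: ConreyIwaniec2002, Proposition 6.4 (6.52) and §8 (8.7)] -/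
theorem integral_three_windows_le (h64 : conreyIwaniec2002_proposition64) :
    ∃ C : ℝ, 0 < C ∧
    ∀ (q : ℕ) [NeZero q], 4 < q → Odd q → ∀ χ : DirichletCharacter ℂ q,
      χ.IsPrimitive → χ.IsQuadratic → χ.Odd →
        ∀ (K : Type) [Field K] [NumberField K],
          Module.finrank ℚ K = 2 → NumberField.discr K = -(q : ℤ) →
            ∀ (ψ : ClassGroup (𝓞 K) →* ℂˣ) (T : ℝ) (a : ℝ → ℂ),
              2 * (q : ℝ) ^ (65 : ℕ) ≤ T →
              IsCutoff a (T / 2) (q * (T / 2)) → IsCutoff a T (q * T) →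
              IsCutoff a (2 * T) (q * (2 * T)) →
                ∫ τ in (T / 2)..(3 * T),
                    ‖LSeries (fun n ↦ a n * twistCount K (classGroupCharIdealHom ψ) n)
                      (1 / 2 + τ * I)‖ ^ 2 ≤
                  C * (T * calL χ T * Real.log q) := by
  obtain ⟨C, hC, h⟩ := h64
  refine ⟨11 / 2 * C, by positivity, ?_⟩
  intro q _ hq hodd χ hprim hquad hχodd K _ _ h2 hdisc ψ T a hT ha1 ha2 ha3
  have hq5 : (5 : ℝ) ≤ q := by exact_mod_cast hq
  have hq1 : (1 : ℝ) ≤ q := by linarith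
  have hqpos : (0 : ℝ) < q := by linarith
  have hq65 : (1 : ℝ) ≤ (q : ℝ) ^ (65 : ℕ) := one_le_pow₀ hq1
  have hT2 : 2 ≤ T := by linarith
  have hT0 : 0 < T := by linarith
  have hlogq : 0 ≤ Real.log q := Real.log_nonneg hq1
  have hcalL0 : 0 ≤ calL χ T := calL_nonneg χ (by linarith)
  -- the function and its continuity
  set g : ℝ → ℝ := fun τ =>
    ‖LSeries (fun n ↦ a n * twistCount K (classGroupCharIdealHom ψ) n) (1 / 2 + τ * I)‖ ^ 2
    with hg
  have hlam := norm_twistCount_le_card_divisors hprim hquad hχodd K h2 hdisc ψ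
  have hY : 0 < q * T := mul_pos hqpos hT0
  have ha : ∀ n : ℕ, 0 < n → ‖a n‖ ≤ (q * T / n) ^ 4 := fun n hn =>
    norm_le_of_isCutoff ha2 hT0.le hY (by exact_mod_cast hn)
  have hcont : Continuous g := by
    rw [hg]
    exact ((continuous_LSeries_cutoff_twist hY ha hlam).norm).pow 2
  have hii : ∀ u v : ℝ, IntervalIntegrable g volume u v := fun u v =>
    hcont.intervalIntegrable u v
  have hg0 : ∀ τ, 0 ≤ g τ := fun τ => by rw [hg]; positivity
  -- the three windows
  have h1 := h q hq hodd χ hprim hquad hχodd K h2 hdisc ψ (T / 2) a (by linarith) ha1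
  have h2' := h q hq hodd χ hprim hquad hχodd K h2 hdisc ψ T a (by linarith) ha2
  have h3 := h q hq hodd χ hprim hquad hχodd K h2 hdisc ψ (2 * T) a (by linarith) ha3
  rw [show 2 * (T / 2) = T by ring] at h1
  -- `∫_{T/2}^{3T} = ∫_{T/2}^{T} + ∫_T^{2T} + ∫_{2T}^{3T}` and `∫_{2T}^{3T} ≤ ∫_{2T}^{4T}`
  have hsplit : ∫ τ in (T / 2)..(3 * T), g τ =
      (∫ τ in (T / 2)..T, g τ) + (∫ τ in T..(2 * T), g τ) + ∫ τ in (2 * T)..(3 * T), g τ := by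
    rw [intervalIntegral.integral_add_adjacent_intervals (hii _ _) (hii _ _),
      intervalIntegral.integral_add_adjacent_intervals (hii _ _) (hii _ _)]
  have hmono : ∫ τ in (2 * T)..(3 * T), g τ ≤ ∫ τ in (2 * T)..(2 * (2 * T)), g τ := by
    have e : (∫ τ in (2 * T)..(3 * T), g τ) + ∫ τ in (3 * T)..(2 * (2 * T)), g τ =
        ∫ τ in (2 * T)..(2 * (2 * T)), g τ :=
      intervalIntegral.integral_add_adjacent_intervals (hii (2 * T) (3 * T))
        (hii (3 * T) (2 * (2 * T)))
    have : 0 ≤ ∫ τ in (3 * T)..(2 * (2 * T)), g τ :=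
      intervalIntegral.integral_nonneg (by linarith) fun u _ => hg0 u
    linarith
  -- `ℒ` comparisons
  have hL1 : calL χ (T / 2) ≤ calL χ T := calL_mono χ (by linarith) (by linarith)
  have hL3 : calL χ (2 * T) ≤ 2 * calL χ T := calL_two_mul_le χ hT2
  have e1 : C * (T / 2 * calL χ (T / 2) * Real.log q) ≤ C * (T / 2 * calL χ T * Real.log q) := by
    gcongr
  have e3 : C * (2 * T * calL χ (2 * T) * Real.log q) ≤
      C * (2 * T * (2 * calL χ T) * Real.log q) := by
    gcongr
  change ∫ τ in (T / 2)..(3 * T), g τ ≤ 11 / 2 * C * (T * calL χ T * Real.log q)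
  rw [hsplit]
  have hsum := add_le_add (add_le_add (h1.trans e1) h2') ((hmono.trans h3).trans e3)
  refine hsum.trans (le_of_eq ?_)
  ring

end ConreyIwaniec2002

end Literature.NumberTheory.LFunctions
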